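import Summits.CriticalPhenomena.PercolationContinuityZ3.Theorems.Transplant.CayleySkeletonSign
import Mathlib.GroupTheory.Index
import Mathlib.GroupTheory.Subgroup.Centralizer
import HarnessLib

/-!
# The cofinite-centraliser datum of `CayleyNeg` from Mathlib's `FiniteIndex`: an element with finite conjugacy class
# (`(Subgroup.centralizer {z}).FiniteIndex`) supplies `reps` and `cofinite`

builds on p205010 (kernel theorem, internal audit signed; external expert review pending) — nothing in this file uses p205010.
Lane `prim-bschramm`, seat `prim-bschramm-p4` (gen 9; PART C3, METHOD = abstract closing argument); helper file
(`--supports stmt-CriticalPhenomena-4575 --as helper`).  Memo `HOME/bschramm/P4-GENERAL.md` §25.  API complement of `CayleySkeletonSign`.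

`CayleyNeg.cofinite` asks for a finite set `reps` with `∀ g ∃ c, cz = zc ∧ c·g ∈ reps` — elementary form of "the centraliser `C_Γ(z)` has finite
index", i.e. "`z` has finitely many conjugates" (an FC-element).  This file derives it from the Mathlib class `(Subgroup.centralizer {z}).FiniteIndex`
(`exists_reps_of_finiteIndex_centralizer`: representatives of the finitely many right cosets via `Quotient.out`), and packages the constructor
`CayleyNeg.ofFiniteIndex`.  [cite: BenjaminiSchramm1996, §2 (Cayley graphs)]
-/

noncomputable section

namespace Summit.CriticalPhenomena.PercolationContinuityZ3.Theorems.Transplant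

open Literature.Probability.LatticeModels SimpleGraph
open scoped Classical

variable {Γ : Type} [Group Γ]

/-- **Finite index of the centraliser gives the cofinite datum**: finitely many representatives `reps` such that every `g` is moved into `reps`
by left multiplication with some `c ∈ C_Γ(z)`. [folklore] -/
theorem exists_reps_of_finiteIndex_centralizer (z : Γ) [hfi : (Subgroup.centralizer ({z} : Set Γ)).FiniteIndex] :
    ∃ reps : Finset Γ, ∀ g : Γ, ∃ c : Γ, c * z = z * c ∧ c * g ∈ reps := by
  set H : Subgroup Γ := Subgroup.centralizer ({z} : Set Γ)
  haveI : Finite (Quotient (QuotientGroup.rightRel H)) :=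
    Finite.of_equiv (Γ ⧸ H) (QuotientGroup.quotientRightRelEquivQuotientLeftRel H).symm
  haveI : Fintype (Quotient (QuotientGroup.rightRel H)) := Fintype.ofFinite _
  refine ⟨Finset.univ.image fun q : Quotient (QuotientGroup.rightRel H) => q.out, fun g => ?_⟩
  set q : Quotient (QuotientGroup.rightRel H) := Quotient.mk _ g
  have hq : QuotientGroup.rightRel H g q.out := Quotient.exact (by rw [Quotient.out_eq])
  rw [QuotientGroup.rightRel_apply] at hq
  -- `hq : q.out * g⁻¹ ∈ H`
  refine ⟨q.out * g⁻¹, ?_, ?_⟩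
  · have h := (Subgroup.mem_centralizer_iff.1 hq) z (Set.mem_singleton z)
    exact h.symm
  · rw [inv_mul_cancel_right]
    exact Finset.mem_image.2 ⟨q, Finset.mem_univ _, rfl⟩

/-- **`CayleyNeg` from an FC-element via Mathlib's `FiniteIndex`** (all other data as given). [cite: BenjaminiSchramm1996, §2 (Cayley graphs)] -/
def CayleyNeg.ofFiniteIndex {S : Finset Γ} (φ : Γ → Site 2) (map_mul : ∀ g h : Γ, φ (g * h) = φ g + φ h)
    (lip : ∀ s ∈ S, ∀ i : Fin 2, |φ s i| ≤ 1) (step : ∀ i : Fin 2, ∃ s ∈ S, φ s = Pi.single i 1) (ν : Γ ≃* Γ)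
    (ν_mem : ∀ s, ν s ∈ S ↔ s ∈ S) (ν_φ : ∀ g, φ (ν g) = -φ g)
    (cyl_connected : ∀ ℓ : ℕ, 1 ≤ ℓ → ((mulCayley (S : Set Γ)).induce {g | φ g ∈ box 2 ℓ}).Connected)
    (z : Γ) [(Subgroup.centralizer ({z} : Set Γ)).FiniteIndex] (z_φ : φ z ≠ 0) : CayleyNeg Γ S where
  φ := φ
  map_mul := map_mul
  lip := lip
  step := step
  ν := ν
  ν_mem := ν_mem
  ν_φ := ν_φ
  cyl_connected := cyl_connected
  z := z
  z_φ := z_φ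
  reps := Classical.choose (exists_reps_of_finiteIndex_centralizer z)
  cofinite := Classical.choose_spec (exists_reps_of_finiteIndex_centralizer z)

end Summit.CriticalPhenomena.PercolationContinuityZ3.Theorems.Transplant

end
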